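/-
Copyright: cell gate-hubbard-kl, typer seat t6. Proof of a named fact of the statement-typer wave.
-/
import Mathlib
import Literature.MathematicalPhysics.QuantumLattice.FermiRG.DR2000PartIModel
import HarnessLib

/-!
# Disertori–Rivasseau 2000, Part I, Lemma 2 «tadpoles vanish»: PROOF (discharge of `Lemma2TadpoleVanishes`)

The printed proof (arXiv:cond-mat/9907130, p0006:L42–72 of the render; [DisertoriRivasseau2000] §II.4.2 Lemma 2) is
followed line by line: the band loop integral `(2π)^{−2}∫d³k C^{Λ_hi}_{Λ_lo}(k)` equals
`−(1/((2π)²β))Σ_{k₀}∫d²k (ik₀ + e)/(k₀² + e²) U`, `U = u((k₀²+e²)/Λ_hi²) − u((k₀²+e²)/Λ_lo²)`; the `ik₀` part is odd in the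
Matsubara frequency; with `t = |k⃗|² − 1` (polar coordinates, `∫d²k = π∫_{−1}^{∞}dt`) the rest is
`π∫_{−1}^{1} dt t/(k₀²+t²) U(k₀²,t²) = 0` by parity, the support of `U` keeping `k₀² + t² ≤ Λ_hi²/2 < 1`.  The `T = 0`
clause integrates the same inner integral over `k₀ ∈ ℝ` (Fubini; the symbol is continuous with compact support).

Main result: `Lemma2TadpoleVanishes_holds : Lemma2TadpoleVanishes`.
-/

noncomputable section

open MeasureTheory Complex Filter Set
open scoped Topology BigOperators

namespace Literature.MathematicalPhysics.QuantumLattice.FermiRG.DR2000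

open Literature.MathematicalPhysics.QuantumLattice

/-! ## 1. Two elementary symmetry facts -/

/-- An odd complex function on `ℝ` has integral zero (no integrability needed) — the printed «= 0 by parity» step.
[cite: DisertoriRivasseau2000, §II.4.2 Lemma 2 (proof) p0006:L63–70] -/
theorem integral_eq_zero_of_odd (f : ℝ → ℂ) (hf : ∀ x, f (-x) = -f x) : ∫ x, f x = 0 := by
  have h1 : ∫ x, f (-x) = ∫ x, f x := by
    simpa using Measure.integral_comp_mul_left f (-1)
  have h2 : ∫ x, f (-x) = -∫ x, f x := by
    rw [← integral_neg]; exact integral_congr_ae (Eventually.of_forall hf)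
  have h3 : (∫ x, f x) = -∫ x, f x := h1.symm.trans h2
  exact self_eq_neg.mp h3

/-- A function on `ℤ` odd under `n ↦ −1 − n` has `tsum` zero (no summability needed) — the printed «the other term is odd
under k₀» step for the Matsubara frequencies `(2n+1)πT`. [cite: DisertoriRivasseau2000, §II.4.2 Lemma 2 (proof) p0006:L59–62] -/
theorem tsum_eq_zero_of_odd_reflect (F : ℤ → ℂ) (hF : ∀ n, F (-1 - n) = -F n) : ∑' n, F n = 0 := by
  have h1 : ∑' n, F ((Equiv.subLeft (-1 : ℤ)) n) = ∑' n, F n := Equiv.tsum_eq _ _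
  have h2 : ∑' n, F ((Equiv.subLeft (-1 : ℤ)) n) = -∑' n, F n := by
    rw [← tsum_neg]; exact tsum_congr fun n => by rw [Equiv.subLeft_apply, hF]
  exact self_eq_neg.mp (h1.symm.trans h2)

/-! ## 2. Radial integrals over the plane: `∫_{ℝ²} G(|k⃗|²) d²k = π ∫₀^∞ G(v) dv` -/

/-- `r ↦ r²` maps `(0,∞)` onto `(0,∞)`. [folklore] -/
private theorem image_sq_Ioi : (fun r : ℝ => r ^ 2) '' Ioi (0 : ℝ) = Ioi 0 := by
  ext v
  constructor
  · rintro ⟨r, hr, rfl⟩; exact pow_pos (mem_Ioi.1 hr) 2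
  · intro hv; exact ⟨Real.sqrt v, Real.sqrt_pos.2 hv, Real.sq_sqrt hv.le⟩

/-- `∫₀^∞ r·G(r²) dr = ½ ∫₀^∞ G(v) dv` (change of variables, no integrability needed). [folklore] -/
private theorem integral_Ioi_mul_comp_sq (G : ℝ → ℂ) :
    ∫ r in Ioi (0 : ℝ), (r : ℂ) * G (r ^ 2) = (1 / 2 : ℂ) * ∫ v in Ioi (0 : ℝ), G v := by
  have hderiv : ∀ r ∈ Ioi (0 : ℝ), HasDerivWithinAt (fun r : ℝ => r ^ 2) (2 * r) (Ioi 0) r := by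
    intro r _
    have h := (hasDerivAt_pow 2 r).hasDerivWithinAt (s := Ioi 0)
    simpa using h
  have hinj : InjOn (fun r : ℝ => r ^ 2) (Ioi 0) := by
    intro a ha b hb h
    simp only at h
    nlinarith [mem_Ioi.1 ha, mem_Ioi.1 hb]
  have h := integral_image_eq_integral_abs_deriv_smul measurableSet_Ioi hderiv hinj G
  rw [image_sq_Ioi] at h
  rw [h, ← integral_const_mul]
  refine setIntegral_congr_fun measurableSet_Ioi fun r hr => ?_
  rw [abs_of_pos (by linarith [mem_Ioi.1 hr]), Complex.real_smul]
  push_cast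
  ring

/-- **Radial reduction**: `∫_{ℝ²} G(k₁² + k₂²) d²k = π ∫_{v>0} G(v) dv` for every `G` (both sides carry Lean's junk
value together; the three changes of variables need no integrability) — the printed «change of variables t = |k⃗|² − 1,
the spatial integral becomes ∫₀^{2π}dθ ∫_{−1}^{∞} dt/2 …» in the variable `v = t + 1`.
[cite: DisertoriRivasseau2000, §II.4.2 Lemma 2 (proof) p0006:L63–68] -/
theorem integral_radial (G : ℝ → ℂ) :
    ∫ k : Fin 2 → ℝ, G (k 0 ^ 2 + k 1 ^ 2) = (Real.pi : ℂ) * ∫ v in Ioi (0 : ℝ), G v := by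
  -- (a) `Fin 2 → ℝ` ≃ `ℝ × ℝ`
  have hmp : MeasurePreserving (MeasurableEquiv.finTwoArrow (α := ℝ)).symm volume volume :=
    (volume_preserving_finTwoArrow ℝ).symm _
  have ha : ∫ k : Fin 2 → ℝ, G (k 0 ^ 2 + k 1 ^ 2) = ∫ p : ℝ × ℝ, G (p.1 ^ 2 + p.2 ^ 2) := by
    rw [← hmp.integral_comp (MeasurableEquiv.measurableEmbedding _)]
    simp [MeasurableEquiv.finTwoArrow_symm_apply]
  -- (b) polar coordinates
  have hb : ∫ p : ℝ × ℝ, G (p.1 ^ 2 + p.2 ^ 2) =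
      ∫ p in polarCoord.target, ((p.1 : ℂ) * G (p.1 ^ 2)) * (fun _ : ℝ => (1 : ℂ)) p.2 := by
    rw [← integral_comp_polarCoord_symm]
    refine setIntegral_congr_fun polarCoord.open_target.measurableSet fun p _ => ?_
    simp only [polarCoord_symm_apply, Complex.real_smul, mul_one]
    congr 2
    have := Real.cos_sq_add_sin_sq p.2
    calc (p.1 * Real.cos p.2) ^ 2 + (p.1 * Real.sin p.2) ^ 2
        = p.1 ^ 2 * (Real.cos p.2 ^ 2 + Real.sin p.2 ^ 2) := by ring
      _ = p.1 ^ 2 := by rw [this, mul_one]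
  -- (c) the target is a product set; split the integral
  have hc : ∫ p in polarCoord.target, ((p.1 : ℂ) * G (p.1 ^ 2)) * (fun _ : ℝ => (1 : ℂ)) p.2 =
      (∫ r in Ioi (0 : ℝ), (r : ℂ) * G (r ^ 2)) * ∫ θ in Ioo (-Real.pi) Real.pi, (1 : ℂ) := by
    rw [polarCoord_target, Measure.volume_eq_prod,
      setIntegral_prod_mul (fun r : ℝ => (r : ℂ) * G (r ^ 2)) (fun _ : ℝ => (1 : ℂ))]
  have hd : ∫ θ in Ioo (-Real.pi) Real.pi, (1 : ℂ) = ((2 * Real.pi : ℝ) : ℂ) := by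
    rw [setIntegral_const, Measure.real, Real.volume_Ioo,
      ENNReal.toReal_ofReal (by linarith [Real.pi_pos]), Complex.real_smul, mul_one]
    push_cast; ring
  rw [ha, hb, hc, hd, integral_Ioi_mul_comp_sq]
  push_cast
  ring

/-! ## 3. The band cutoff: support properties -/

section Cutoff

variable {u : ℝ → ℝ} {Λlo Λhi : ℝ}

/-- Far from the Fermi surface (`r > 1/2`, scales `Λ ≤ Λ₀ = 1`) the band cutoff vanishes: `u(r/Λ²) = 0` for
`r/Λ² > 1/2`. [cite: DisertoriRivasseau2000, §II.4.2 Lemma 2 p0006:L70–72] -/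
theorem bandCutoff_eq_zero_of_half_lt (hu : IsCutoff u) (hlo : 0 < Λlo) (hle : Λlo ≤ Λhi) (hhi : Λhi ≤ 1)
    {r : ℝ} (hr : 1 / 2 < r) : bandCutoff u Λlo Λhi r = 0 := by
  have hr0 : 0 < r := by linarith
  have key : ∀ Λ : ℝ, 0 < Λ → Λ ≤ 1 → u (r / Λ ^ 2) = 0 := by
    intro Λ hΛ hΛ1
    apply hu.eq_zero
    have hΛ2 : Λ ^ 2 ≤ 1 := pow_le_one₀ hΛ.le hΛ1
    have h1 : r ≤ r / Λ ^ 2 := by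
      rw [le_div_iff₀ (by positivity)]
      nlinarith
    rw [abs_of_pos (by positivity)]
    linarith
  have hhi0 : 0 < Λhi := lt_of_lt_of_le hlo hle
  simp [bandCutoff, key Λhi hhi0 hhi, key Λlo hlo (hle.trans hhi)]

/-- Near the Fermi surface (`|r| < Λ_lo²/4`) both cutoffs equal `1` and the band cutoff vanishes.
[cite: DisertoriRivasseau2000, §II.4.2 Lemma 2 p0006:L55–58] -/
theorem bandCutoff_eq_zero_of_abs_lt (hu : IsCutoff u) (hlo : 0 < Λlo) (hle : Λlo ≤ Λhi)
    {r : ℝ} (hr : |r| < Λlo ^ 2 / 4) : bandCutoff u Λlo Λhi r = 0 := by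
  have key : ∀ Λ : ℝ, Λlo ≤ Λ → u (r / Λ ^ 2) = 1 := by
    intro Λ hΛ
    have hΛ0 : 0 < Λ := lt_of_lt_of_le hlo hΛ
    apply hu.eq_one
    rw [abs_div, abs_of_pos (by positivity : 0 < Λ ^ 2), div_lt_iff₀ (by positivity)]
    have : Λlo ^ 2 ≤ Λ ^ 2 := by gcongr
    linarith
  simp [bandCutoff, key Λhi hle, key Λlo le_rfl]

/-- The band cutoff is continuous. [cite: DisertoriRivasseau2000, §II.2 (II.13) p0004:L12–16] -/
theorem continuous_bandCutoff (hu : IsCutoff u) : Continuous (bandCutoff u Λlo Λhi) := by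
  unfold bandCutoff
  exact (hu.smooth.continuous.comp (continuous_id.div_const _)).sub
    (hu.smooth.continuous.comp (continuous_id.div_const _))

end Cutoff

/-! ## 4. The one-dimensional integral in `t = |k⃗|² − 1` -/

section OneDim

variable {u : ℝ → ℝ} {Λlo Λhi : ℝ}

/-- `φ_{k₀}(t) = U(k₀² + t²)/(k₀² + t²)` (even in `t` and in `k₀`). [cite: DisertoriRivasseau2000, §II.4.2 Lemma 2 p0006:L60–66] -/
def phiFn (u : ℝ → ℝ) (Λlo Λhi k₀ t : ℝ) : ℝ := bandCutoff u Λlo Λhi (k₀ ^ 2 + t ^ 2) / (k₀ ^ 2 + t ^ 2)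

/-- `J(k₀) = ∫ φ_{k₀}`. [cite: DisertoriRivasseau2000, §II.4.2 Lemma 2 p0006:L60–66] -/
def jFn (u : ℝ → ℝ) (Λlo Λhi k₀ : ℝ) : ℝ := ∫ t, phiFn u Λlo Λhi k₀ t

/-- The integrand after polar coordinates: `g_{k₀}(t) = U(k₀² + t²)/(ik₀ − t)`.
[cite: DisertoriRivasseau2000, §II.4.2 Lemma 2 p0006:L60–66] -/
def gFn (u : ℝ → ℝ) (Λlo Λhi k₀ t : ℝ) : ℂ :=
  1 / (I * (k₀ : ℂ) - (t : ℂ)) * (bandCutoff u Λlo Λhi (k₀ ^ 2 + t ^ 2) : ℂ)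

/-- `J` is even in `k₀`. [cite: DisertoriRivasseau2000, §II.4.2 Lemma 2 p0006:L60–66] -/
theorem jFn_neg (k₀ : ℝ) : jFn u Λlo Λhi (-k₀) = jFn u Λlo Λhi k₀ := by
  simp [jFn, phiFn]

/-- `g_{k₀}(t) = 0` for `|t| ≥ 1` («the domain of t can be reduced to [−1,1]»).
[cite: DisertoriRivasseau2000, §II.4.2 Lemma 2 p0006:L70–72] -/
theorem gFn_eq_zero_of_one_le_abs (hu : IsCutoff u) (hlo : 0 < Λlo) (hle : Λlo ≤ Λhi) (hhi : Λhi ≤ 1)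
    (k₀ : ℝ) {t : ℝ} (ht : 1 ≤ |t|) : gFn u Λlo Λhi k₀ t = 0 := by
  have h1 : 1 ≤ t ^ 2 := by nlinarith [abs_nonneg t, sq_abs t]
  have h2 : 1 / 2 < k₀ ^ 2 + t ^ 2 := by nlinarith [sq_nonneg k₀]
  simp [gFn, bandCutoff_eq_zero_of_half_lt hu hlo hle hhi h2]

/-- `∫ g_{k₀} = −ik₀ J(k₀)`: the `t`-odd part drops out. [cite: DisertoriRivasseau2000, §II.4.2 Lemma 2 p0006:L60–72] -/
theorem integral_gFn (hu : IsCutoff u) (hlo : 0 < Λlo) (hle : Λlo ≤ Λhi) (hhi : Λhi ≤ 1) (k₀ : ℝ) :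
    ∫ t, gFn u Λlo Λhi k₀ t = -(I * k₀) * (jFn u Λlo Λhi k₀ : ℂ) := by
  by_cases hk : k₀ = 0
  · subst hk
    simp only [Complex.ofReal_zero, mul_zero, neg_zero, zero_mul]
    apply integral_eq_zero_of_odd
    intro t
    simp only [gFn, Complex.ofReal_zero, mul_zero, zero_sub, Complex.ofReal_neg, neg_neg, even_two.neg_pow]
    rw [one_div, one_div, inv_neg]
    ring
  -- `k₀ ≠ 0`: denominators are harmless
  have hden : ∀ t : ℝ, (I * (k₀ : ℂ) - (t : ℂ)) ≠ 0 := by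
    intro t h
    have := congrArg Complex.im h
    simp at this
    exact hk this
  have hpos : ∀ t : ℝ, 0 < k₀ ^ 2 + t ^ 2 := fun t => by positivity
  have hUc : Continuous (bandCutoff u Λlo Λhi) := continuous_bandCutoff hu
  have hφc : Continuous (phiFn u Λlo Λhi k₀) := by
    unfold phiFn
    exact (hUc.comp (continuous_const.add (continuous_pow 2))).div
      (continuous_const.add (continuous_pow 2)) fun t => (hpos t).ne'
  -- support in `[-1, 1]`
  have hφ0 : ∀ t : ℝ, t ∉ Icc (-1 : ℝ) 1 → phiFn u Λlo Λhi k₀ t = 0 := by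
    intro t ht
    have h1 : 1 < |t| := by
      rw [mem_Icc, not_and_or, not_le, not_le] at ht
      rcases ht with h | h
      · rw [abs_of_neg (by linarith)]; linarith
      · rw [abs_of_pos (by linarith)]; linarith
    have h2 : 1 / 2 < k₀ ^ 2 + t ^ 2 := by nlinarith [abs_nonneg t, sq_abs t, sq_nonneg k₀]
    simp [phiFn, bandCutoff_eq_zero_of_half_lt hu hlo hle hhi h2]
  have hφsupp : HasCompactSupport (phiFn u Λlo Λhi k₀) :=
    HasCompactSupport.intro (K := Icc (-1 : ℝ) 1) isCompact_Icc hφ0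
  have hφint : Integrable (phiFn u Λlo Λhi k₀) := hφc.integrable_of_hasCompactSupport hφsupp
  have htφc : Continuous (fun t : ℝ => t * phiFn u Λlo Λhi k₀ t) := continuous_id.mul hφc
  have htφsupp : HasCompactSupport (fun t : ℝ => t * phiFn u Λlo Λhi k₀ t) :=
    HasCompactSupport.intro (K := Icc (-1 : ℝ) 1) isCompact_Icc fun t ht => by simp [hφ0 t ht]
  have htφint : Integrable (fun t : ℝ => t * phiFn u Λlo Λhi k₀ t) := htφc.integrable_of_hasCompactSupport htφsupp
  -- pointwise algebra: `1/(ik₀ − t) · U = (−ik₀ − t) φ`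
  have hpt : ∀ t : ℝ, gFn u Λlo Λhi k₀ t =
      -(I * k₀) * (phiFn u Λlo Λhi k₀ t : ℂ) - ((t * phiFn u Λlo Λhi k₀ t : ℝ) : ℂ) := by
    intro t
    have hr : ((k₀ : ℂ) ^ 2 + (t : ℂ) ^ 2) ≠ 0 := by exact_mod_cast (hpos t).ne'
    have hprod : (I * (k₀ : ℂ) - (t : ℂ)) * (-(I * (k₀ : ℂ)) - (t : ℂ)) = (k₀ : ℂ) ^ 2 + (t : ℂ) ^ 2 := by
      ring_nf
      rw [Complex.I_sq]
      ring
    have hinv : 1 / (I * (k₀ : ℂ) - (t : ℂ)) = (-(I * (k₀ : ℂ)) - (t : ℂ)) / ((k₀ : ℂ) ^ 2 + (t : ℂ) ^ 2) := by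
      rw [div_eq_div_iff (hden t) hr, one_mul, ← hprod]
      ring
    simp only [gFn, phiFn]
    push_cast
    rw [hinv]
    ring
  simp_rw [hpt]
  rw [integral_sub (hφint.ofReal.const_mul _) htφint.ofReal, integral_const_mul, integral_complex_ofReal,
    integral_complex_ofReal]
  have hodd : ∫ t : ℝ, t * phiFn u Λlo Λhi k₀ t = 0 := by
    have := integral_eq_zero_of_odd (fun t : ℝ => ((t * phiFn u Λlo Λhi k₀ t : ℝ) : ℂ)) fun t => by
      simp [phiFn]
    rw [integral_complex_ofReal] at this
    exact_mod_cast this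
  rw [hodd, jFn]
  simp

end OneDim

/-! ## 5. The inner integral over `k⃗` at fixed `k₀` -/

section Inner

variable {u : ℝ → ℝ} {Λlo Λhi : ℝ}

/-- The band symbol at fixed `k₀` as a function of `v = |k⃗|²`. [cite: DisertoriRivasseau2000, §II.4.2 Lemma 2 p0006:L60–66] -/
def radialG (u : ℝ → ℝ) (Λlo Λhi k₀ v : ℝ) : ℂ :=
  1 / (I * (k₀ : ℂ) - ((v - 1 : ℝ) : ℂ)) * (bandCutoff u Λlo Λhi (k₀ ^ 2 + (v - 1) ^ 2) : ℂ)

/-- The band symbol is radial in `k⃗`. [cite: DisertoriRivasseau2000, §II.4.2 Lemma 2 p0006:L60–66] -/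
theorem bandSymbol_eq_radialG (k₀ : ℝ) (k : Fin 2 → ℝ) :
    bandSymbol u Λlo Λhi (k₀, k) = radialG u Λlo Λhi k₀ (k 0 ^ 2 + k 1 ^ 2) := by
  simp only [bandSymbol, freeSymbol, rOf, dispersion, radialG]

/-- The change of variables `t = v − 1 = |k⃗|² − 1`. [cite: DisertoriRivasseau2000, §II.4.2 Lemma 2 p0006:L63–66] -/
theorem radialG_shift (k₀ t : ℝ) : radialG u Λlo Λhi k₀ (t + 1) = gFn u Λlo Λhi k₀ t := by
  simp only [radialG, gFn, add_sub_cancel_right]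

/-- `∫d²k C^{Λ_hi}_{Λ_lo}(k₀, k⃗) = π·(−ik₀ J(k₀))`: polar coordinates, `t = |k⃗|² − 1`, parity in `t`.
[cite: DisertoriRivasseau2000, §II.4.2 Lemma 2 p0006:L55–72] -/
theorem integral_inner (hu : IsCutoff u) (hlo : 0 < Λlo) (hle : Λlo ≤ Λhi) (hhi : Λhi ≤ 1) (k₀ : ℝ) :
    ∫ k : Fin 2 → ℝ, bandSymbol u Λlo Λhi (k₀, k) = (Real.pi : ℂ) * (-(I * k₀) * (jFn u Λlo Λhi k₀ : ℂ)) := by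
  simp_rw [bandSymbol_eq_radialG]
  rw [integral_radial]
  congr 1
  have hIoi : Ioi (0 : ℝ) = (fun t : ℝ => t + 1) '' Ioi (-1) := by
    rw [image_add_const_Ioi]; norm_num
  have hderiv : ∀ t ∈ Ioi (-1 : ℝ), HasDerivWithinAt (fun t : ℝ => t + 1) (1 : ℝ) (Ioi (-1)) t :=
    fun t _ => by simpa using ((hasDerivAt_id t).add_const (1 : ℝ)).hasDerivWithinAt
  have hinj : InjOn (fun t : ℝ => t + 1) (Ioi (-1)) := fun a _ b _ h => by simpa using h
  rw [hIoi, integral_image_eq_integral_abs_deriv_smul measurableSet_Ioi hderiv hinj]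
  simp only [abs_one, one_smul, radialG_shift]
  rw [setIntegral_eq_integral_of_forall_compl_eq_zero fun t ht => ?_]
  · exact integral_gFn hu hlo hle hhi k₀
  · rw [mem_Ioi, not_lt] at ht
    exact gFn_eq_zero_of_one_le_abs hu hlo hle hhi k₀ (by rw [abs_of_nonpos (by linarith)]; linarith)

end Inner

/-! ## 6. Continuity and compact support of the band symbol (for Fubini in the `T = 0` clause) -/

section Symbol

variable {u : ℝ → ℝ} {Λlo Λhi : ℝ}

/-- `ψ(r) = U(r)/r`, continuous because `U ≡ 0` near `r = 0`. [cite: DisertoriRivasseau2000, §II.4.2 Lemma 2 p0006:L55–58] -/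
def psiFn (u : ℝ → ℝ) (Λlo Λhi r : ℝ) : ℝ := bandCutoff u Λlo Λhi r / r

/-- `ψ` is continuous. [cite: DisertoriRivasseau2000, §II.4.2 Lemma 2 p0006:L55–58] -/
theorem continuous_psiFn (hu : IsCutoff u) (hlo : 0 < Λlo) (hle : Λlo ≤ Λhi) : Continuous (psiFn u Λlo Λhi) := by
  have hUc : Continuous (bandCutoff u Λlo Λhi) := continuous_bandCutoff hu
  refine continuous_iff_continuousAt.2 fun r => ?_
  by_cases hr : r = 0
  · subst hr
    have hev : ∀ᶠ x in 𝓝 (0 : ℝ), (fun _ : ℝ => (0 : ℝ)) x = psiFn u Λlo Λhi x := by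
      have : ∀ᶠ x in 𝓝 (0 : ℝ), |x - 0| < Λlo ^ 2 / 4 := eventually_abs_sub_lt 0 (by positivity)
      filter_upwards [this] with x hx
      rw [sub_zero] at hx
      simp [psiFn, bandCutoff_eq_zero_of_abs_lt hu hlo hle hx]
    exact (continuousAt_const : ContinuousAt (fun _ : ℝ => (0 : ℝ)) 0).congr hev
  · exact hUc.continuousAt.div continuousAt_id hr

/-- `C(k)U(r) = (−ik₀ − e)·ψ(r)` with `r = k₀² + e²` («the integral reduces to −(1/((2π)²β))Σ∫ (ik₀ + e)/(k₀² + e²) U»).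
[cite: DisertoriRivasseau2000, §II.4.2 Lemma 2 p0006:L47–54] -/
theorem bandSymbol_eq_psi (hu : IsCutoff u) (hlo : 0 < Λlo) (hle : Λlo ≤ Λhi) (p : Mom) :
    bandSymbol u Λlo Λhi p = (-(I * (p.1 : ℂ)) - (dispersion p.2 : ℂ)) * (psiFn u Λlo Λhi (rOf p) : ℂ) := by
  by_cases h : rOf p = 0
  · have hU : bandCutoff u Λlo Λhi (rOf p) = 0 := by
      rw [h]; exact bandCutoff_eq_zero_of_abs_lt hu hlo hle (by rw [abs_zero]; positivity)
    simp [bandSymbol, psiFn, hU]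
  · have hr : ((rOf p : ℝ) : ℂ) ≠ 0 := by exact_mod_cast h
    have hprod : (I * (p.1 : ℂ) - (dispersion p.2 : ℂ)) * (-(I * (p.1 : ℂ)) - (dispersion p.2 : ℂ)) =
        ((rOf p : ℝ) : ℂ) := by
      simp only [rOf]
      push_cast
      ring_nf
      rw [Complex.I_sq]
      ring
    have hA : (I * (p.1 : ℂ) - (dispersion p.2 : ℂ)) ≠ 0 := by
      intro h0; apply hr; rw [← hprod, h0, zero_mul]
    have hinv : 1 / (I * (p.1 : ℂ) - (dispersion p.2 : ℂ)) =
        (-(I * (p.1 : ℂ)) - (dispersion p.2 : ℂ)) / ((rOf p : ℝ) : ℂ) := by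
      rw [div_eq_div_iff hA hr, one_mul, ← hprod]; ring
    simp only [bandSymbol, freeSymbol, psiFn]
    push_cast
    rw [hinv]
    ring

/-- The band symbol is continuous on `ℝ × ℝ²`. [cite: DisertoriRivasseau2000, §II.4.2 Lemma 2 p0006:L47–58] -/
theorem continuous_bandSymbol (hu : IsCutoff u) (hlo : 0 < Λlo) (hle : Λlo ≤ Λhi) :
    Continuous (bandSymbol u Λlo Λhi) := by
  have h : bandSymbol u Λlo Λhi =
      fun p : Mom => (-(I * (p.1 : ℂ)) - (dispersion p.2 : ℂ)) * (psiFn u Λlo Λhi (rOf p) : ℂ) :=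
    funext (bandSymbol_eq_psi hu hlo hle)
  rw [h]
  have hd : Continuous fun p : Mom => dispersion p.2 := by unfold dispersion; fun_prop
  have hr : Continuous fun p : Mom => rOf p := by unfold rOf dispersion; fun_prop
  have hψ : Continuous fun p : Mom => psiFn u Λlo Λhi (rOf p) := (continuous_psiFn hu hlo hle).comp hr
  exact (((continuous_const.mul (Complex.continuous_ofReal.comp continuous_fst)).neg.sub
    (Complex.continuous_ofReal.comp hd)).mul (Complex.continuous_ofReal.comp hψ))

/-- The band symbol vanishes outside the ball of radius `2` (its support has `k₀² + e² ≤ 1/2`).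
[cite: DisertoriRivasseau2000, §II.4.2 Lemma 2 p0006:L55–58, L70–72] -/
theorem bandSymbol_eq_zero_of_norm (hu : IsCutoff u) (hlo : 0 < Λlo) (hle : Λlo ≤ Λhi) (hhi : Λhi ≤ 1)
    {p : Mom} (hp : 2 < ‖p‖) : bandSymbol u Λlo Λhi p = 0 := by
  have hr : 1 / 2 < rOf p := by
    rw [Prod.norm_def] at hp
    rcases lt_max_iff.1 hp with h1 | h2
    · rw [Real.norm_eq_abs] at h1
      have : 4 < p.1 ^ 2 := by nlinarith [abs_nonneg p.1, sq_abs p.1]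
      unfold rOf
      nlinarith [sq_nonneg (dispersion p.2)]
    · have hex : ∃ i, 2 < |p.2 i| := by
        by_contra hcon
        simp only [not_exists, not_lt] at hcon
        have : ‖p.2‖ ≤ 2 := (pi_norm_le_iff_of_nonneg (by norm_num)).2 fun i => by
          rw [Real.norm_eq_abs]; exact hcon i
        linarith
      obtain ⟨i, hi⟩ := hex
      have hi2 : 4 < p.2 i ^ 2 := by nlinarith [abs_nonneg (p.2 i), sq_abs (p.2 i)]
      have hsum : 4 < p.2 0 ^ 2 + p.2 1 ^ 2 := by
        fin_cases i
        · simp only [Fin.zero_eta] at hi2; nlinarith [sq_nonneg (p.2 1)]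
        · simp only [Fin.mk_one] at hi2; nlinarith [sq_nonneg (p.2 0)]
      have hd : 3 < dispersion p.2 := by unfold dispersion; linarith
      unfold rOf
      nlinarith [sq_nonneg p.1]
  simp [bandSymbol, bandCutoff_eq_zero_of_half_lt hu hlo hle hhi hr]

/-- The band symbol has compact support. [cite: DisertoriRivasseau2000, §II.4.2 Lemma 2 p0006:L55–58] -/
theorem hasCompactSupport_bandSymbol (hu : IsCutoff u) (hlo : 0 < Λlo) (hle : Λlo ≤ Λhi) (hhi : Λhi ≤ 1) :
    HasCompactSupport (bandSymbol u Λlo Λhi) :=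
  HasCompactSupport.intro (K := Metric.closedBall (0 : Mom) 2) (isCompact_closedBall 0 2) fun p hp =>
    bandSymbol_eq_zero_of_norm hu hlo hle hhi (by rwa [Metric.mem_closedBall, dist_zero_right, not_le] at hp)

/-- The band symbol is integrable on `ℝ × ℝ²`. [cite: DisertoriRivasseau2000, §II.4.2 Lemma 2 p0006:L47–58] -/
theorem integrable_bandSymbol (hu : IsCutoff u) (hlo : 0 < Λlo) (hle : Λlo ≤ Λhi) (hhi : Λhi ≤ 1) :
    Integrable (bandSymbol u Λlo Λhi) :=
  (continuous_bandSymbol hu hlo hle).integrable_of_hasCompactSupport (hasCompactSupport_bandSymbol hu hlo hle hhi)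

end Symbol

/-! ## 7. The two clauses and the discharge -/

section Main

variable {u : ℝ → ℝ} {Λlo Λhi : ℝ}

/-- At coinciding points the phase is trivial. [cite: DisertoriRivasseau2000, §II.1 (II.5) p0003:L64–65] -/
theorem pairing_zero (p : Mom) : pairing p 0 = 0 := by simp [pairing]

/-- **Matsubara clause**: `(T/(2π)²)Σ_n ∫d²k C^{Λ_hi}_{Λ_lo}((2n+1)πT, k⃗) = 0` — the summand is odd under `n ↦ −1−n`.
[cite: DisertoriRivasseau2000, §II.4.2 Lemma 2 p0006:L47–62] -/
theorem thermalKernel_bandSymbol_zero (hu : IsCutoff u) (hlo : 0 < Λlo) (hle : Λlo ≤ Λhi) (hhi : Λhi ≤ 1)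
    (T : ℝ) : thermalKernel T (bandSymbol u Λlo Λhi) 0 = 0 := by
  unfold thermalKernel
  simp_rw [pairing_zero, Complex.ofReal_zero, zero_mul, Complex.exp_zero, one_mul, matsubaraMom,
    integral_inner hu hlo hle hhi]
  rw [tsum_eq_zero_of_odd_reflect, mul_zero]
  intro n
  have hk : fermiMatsubara (1 / T) (-1 - n) = -fermiMatsubara (1 / T) n := by
    simp only [fermiMatsubara]
    push_cast
    ring
  rw [hk, Complex.ofReal_neg, jFn_neg]
  ring

/-- **Zero-temperature clause**: `∫d³k C^{Λ_hi}_{Λ_lo}(k) = 0` (Fubini, then the `k₀`-integrand is odd).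
[cite: DisertoriRivasseau2000, §II.4.2 Lemma 2 p0006:L47–72] -/
theorem zeroKernel_bandSymbol_zero (hu : IsCutoff u) (hlo : 0 < Λlo) (hle : Λlo ≤ Λhi) (hhi : Λhi ≤ 1) :
    zeroKernel (bandSymbol u Λlo Λhi) 0 = 0 := by
  unfold zeroKernel
  simp_rw [pairing_zero, Complex.ofReal_zero, zero_mul, Complex.exp_zero, one_mul]
  have hI : Integrable (bandSymbol u Λlo Λhi) ((volume : Measure ℝ).prod (volume : Measure (Fin 2 → ℝ))) := by
    rw [← Measure.volume_eq_prod]; exact integrable_bandSymbol hu hlo hle hhi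
  rw [Measure.volume_eq_prod, integral_prod _ hI]
  simp_rw [integral_inner hu hlo hle hhi]
  rw [integral_eq_zero_of_odd, mul_zero]
  intro k₀
  rw [Complex.ofReal_neg, jFn_neg]
  ring

/-- **Lemma 2 of [DR1] holds**: tadpoles vanish in every band, at every temperature `T > 0` and at `T = 0`
(discharge of the named fact `Lemma2TadpoleVanishes`). [cite: DisertoriRivasseau2000, §II.4.2 Lemma 2 p0006:L42–72] -/
theorem Lemma2TadpoleVanishes_holds : Lemma2TadpoleVanishes := by
  intro u hu Λlo Λhi hlo hle hhi
  exact ⟨fun T _ => thermalKernel_bandSymbol_zero hu hlo hle hhi T, zeroKernel_bandSymbol_zero hu hlo hle hhi⟩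

end Main

end Literature.MathematicalPhysics.QuantumLattice.FermiRG.DR2000

end
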